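import Summits.ABC.ABC.Theorems.ParitySliceConcordantNormsAssembly

/-!
# Equivalence audit for the crux `NonSquareTopABC` (stmt-ABC-4010) — crux-strategist q1 workfile

Seat `planner-cstrat-stmt-ABC-4010-q1-0` (2026-08-17), SUSPECT-EQUIVALENCE check on route
`ParitySliceConcordantNorms` (route-ABC-parity-slice-concordant-norms), whose deciding theorem is
`closes (hT : NonSquareTopABC) (hR : SquareTopResidualFinite) (hA : Assembly) : ABC := hA hT hR`.

* §1 records the flagged equivalence as a checked statement over the LANDED sibling
  `Summit.ABC.ABC.Theorems.paritySliceConcordantNorms_assembly : Assembly`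
  (Theorems/ParitySliceConcordantNormsAssembly.lean, p171173, commit b39756878ac2; 3 files, 688 lines, 22
  theorems, axioms `propext / Classical.choice / Quot.sound`):
  `SquareTopResidualFinite → (ABC ↔ NonSquareTopABC)`.
* §2 makes refuter objection O1 (rreview-35feb902, 2026-08-15) exact: the DISCARDED half of the parity cut,
  abc for SQUARE tops, is ABC-complete as well, by the degree-2 breeding `(a, b, c) ↦ (a², b(2a+b), c²)`
  (`a² + b(2a+b) = c²`, coprime, `rad ≤ 2c·rad(abc)`, exponent loss `ε/3 ↦ ε`).  Hence, unconditionally,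
  `ABC ↔ SquareTopABC`, and given the Faltings-grade residual `NonSquareTopABC ↔ SquareTopABC`: the parity
  of the top is a two-sided WLOG.  This is the formal content of the verdict "equivalence-benign (substantive
  sibling) but toothless (no piece of difficulty is isolated by the parity language)".

Sorry-free; standard axioms; reuses the landed helper API `Summit.ABC.ABC.Theorems.ParitySliceAssembly.*`.
-/

set_option linter.dupNamespace false

namespace Summit.ABC.ABC.Cruxes.NonSquareTopABC.EquivalenceAudit

open Literature.NumberTheory.DiophantineGeometry
open Summit.ABC.ABC.Theses.ParitySliceConcordantNorms
open Summit.ABC.ABC.Theorems Summit.ABC.ABC.Theorems.ParitySliceAssembly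
open UniqueFactorizationMonoid

/-! ## §1 The flagged equivalence, over the landed sibling -/

/-- The summit gives the crux by restriction (the cheap direction). -/
theorem abc_imp_nonSquareTopABC : _root_.ABC → NonSquareTopABC := by
  intro h ε hε
  obtain ⟨C, hC, H⟩ := h ε hε
  exact ⟨C, hC, fun a b c ht _ => H a b c ht⟩

/-- **The equivalence the hub flagged**, as a tree-checked statement: modulo the Faltings-grade sibling
`SquareTopResidualFinite` (stmt-ABC-4015, open in the tree, a theorem in print), the crux IS the summit.
The non-trivial direction is the landed 688-line Assembly (six Belyi breedings). -/
theorem abc_iff_nonSquareTopABC (hR : SquareTopResidualFinite) : _root_.ABC ↔ NonSquareTopABC :=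
  ⟨abc_imp_nonSquareTopABC, fun hT => paritySliceConcordantNorms_assembly hT hR⟩

/-! ## §2 The discarded half is ABC-complete too (refuter O1, exact) -/

/-- abc for abc-triples whose top IS a perfect square — the half of the parity cut the route discards. -/
def SquareTopABC : Prop :=
  ∀ ε : ℝ, 0 < ε → ∃ C : ℝ, 0 < C ∧ ∀ a b c : ℕ, IsABCTriple a b c → IsSquare c →
    (c : ℝ) < C * ((rad a b c : ℕ) : ℝ) ^ (1 + ε)

/-- Restriction. -/
theorem abc_imp_squareTopABC : _root_.ABC → SquareTopABC := by
  intro h ε hε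
  obtain ⟨C, hC, H⟩ := h ε hε
  exact ⟨C, hC, fun a b c ht _ => H a b c ht⟩

/-- **The degree-2 breeding INTO square tops** (van der Horst / de Weger 2023 §3.6 'triples from triples';
refuter O1): `(a, b, c) ↦ (a², b(2a+b), c²)` is a coprime abc-triple with square top, `c² ≤ C'` and
`rad' ≤ 2c · rad(abc)`. -/
theorem breed_sq {a b c : ℕ} (ht : IsABCTriple a b c) :
    ∃ A B C : ℕ, IsABCTriple A B C ∧ IsSquare C ∧ c ^ 2 ≤ C ∧ rad A B C ≤ 2 * c * rad a b c := by
  obtain ⟨ha, hb, rfl, hcop⟩ := ht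
  refine ⟨a ^ 2, b * (2 * a + b), (a + b) ^ 2, ⟨by positivity, by positivity, by ring, ?_⟩,
    ⟨a + b, sq (a + b)⟩, le_rfl, ?_⟩
  · -- coprimality: gcd(a, b) = 1 ⇒ gcd(a, 2a+b) = 1 ⇒ gcd(a², b(2a+b)) = 1
    exact Nat.Coprime.pow_left 2
      (Nat.Coprime.mul_right hcop ((Nat.coprime_mul_right_add_right a b 2).mpr hcop))
  · -- radical: rad(a² · b(2a+b) · c²) ≤ rad(abc) · (2a+b) ≤ 2c · rad(abc)
    have e : a ^ 2 * (b * (2 * a + b)) * (a + b) ^ 2 =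
        (a ^ 2 * b ^ 1 * (a + b) ^ 2) * ((2 * a + b) ^ 1 * 1) := by ring
    rw [rad_def (a ^ 2), e]
    calc radical ((a ^ 2 * b ^ 1 * (a + b) ^ 2) * ((2 * a + b) ^ 1 * 1))
          ≤ rad a b (a + b) * ((2 * a + b) * 1) :=
          radical_bred_le ha hb (by positivity) (by norm_num) (by norm_num) (by norm_num)
            (by positivity) one_ne_zero
      _ ≤ rad a b (a + b) * (2 * (a + b)) := Nat.mul_le_mul_left _ (by omega)
      _ = 2 * (a + b) * rad a b (a + b) := by ring

/-- Transfer of the square-top bound at exponent `1 + η` (`0 < η ≤ 1`) through the degree-2 breeding: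
`c^(1-η) < 4·C₁ · rad^(1+η)` for the original triple. -/
theorem transfer_sq {η C₁ : ℝ} (hη : 0 < η) (hη1 : η ≤ 1) (hC₁ : 0 < C₁)
    (H : ∀ a b c : ℕ, IsABCTriple a b c → IsSquare c →
      (c : ℝ) < C₁ * ((rad a b c : ℕ) : ℝ) ^ (1 + η))
    {a b c A B C : ℕ} (hc : 0 < c) (hT : IsABCTriple A B C) (hsq : IsSquare C) (hsize : c ^ 2 ≤ C)
    (hrad : rad A B C ≤ 2 * c * rad a b c) :
    (c : ℝ) ^ (1 - η) < (4 * C₁) * ((rad a b c : ℕ) : ℝ) ^ (1 + η) := by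
  have hCb := H A B C hT hsq
  have hR1 := one_le_rad_real a b c
  have hc1 : (1 : ℝ) ≤ c := by exact_mod_cast hc
  have hx : (0 : ℝ) < c := by positivity
  have hsizeR : (c : ℝ) ^ (2 : ℝ) ≤ (C : ℝ) := by
    rw [Real.rpow_two]; exact_mod_cast hsize
  have hradR : ((rad A B C : ℕ) : ℝ) ≤ 2 * (c : ℝ) * ((rad a b c : ℕ) : ℝ) := by exact_mod_cast hrad
  have h1 : (C : ℝ) < C₁ * (2 * (c : ℝ) * ((rad a b c : ℕ) : ℝ)) ^ (1 + η) := by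
    calc (C : ℝ) < C₁ * ((rad A B C : ℕ) : ℝ) ^ (1 + η) := hCb
      _ ≤ C₁ * (2 * (c : ℝ) * ((rad a b c : ℕ) : ℝ)) ^ (1 + η) := by gcongr
  have h2 : (2 * (c : ℝ) * ((rad a b c : ℕ) : ℝ)) ^ (1 + η) =
      (2 : ℝ) ^ (1 + η) * (c : ℝ) ^ (1 + η) * ((rad a b c : ℕ) : ℝ) ^ (1 + η) := by
    rw [Real.mul_rpow (by positivity) (by positivity), Real.mul_rpow (by positivity) (by positivity)]
  have h24 : (2 : ℝ) ^ (1 + η) ≤ 4 := by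
    calc (2 : ℝ) ^ (1 + η) ≤ (2 : ℝ) ^ (2 : ℝ) :=
          Real.rpow_le_rpow_of_exponent_le (by norm_num) (by linarith)
      _ = 4 := by rw [Real.rpow_two]; norm_num
  have h3 : (c : ℝ) ^ (2 : ℝ) < (4 * C₁) * (c : ℝ) ^ (1 + η) * ((rad a b c : ℕ) : ℝ) ^ (1 + η) := by
    have hcpow : (0 : ℝ) ≤ (c : ℝ) ^ (1 + η) := by positivity
    have hRpow : (0 : ℝ) ≤ ((rad a b c : ℕ) : ℝ) ^ (1 + η) := by positivity
    calc (c : ℝ) ^ (2 : ℝ) ≤ C := hsizeR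
      _ < C₁ * ((2 : ℝ) ^ (1 + η) * (c : ℝ) ^ (1 + η) * ((rad a b c : ℕ) : ℝ) ^ (1 + η)) := by
          rw [← h2]; exact h1
      _ ≤ C₁ * (4 * (c : ℝ) ^ (1 + η) * ((rad a b c : ℕ) : ℝ) ^ (1 + η)) := by gcongr
      _ = _ := by ring
  have h4 : (c : ℝ) ^ ((2 : ℝ) - (1 + η)) < (4 * C₁) * ((rad a b c : ℕ) : ℝ) ^ (1 + η) := by
    rw [Real.rpow_sub hx, div_lt_iff₀ (by positivity)]
    calc (c : ℝ) ^ (2 : ℝ) < _ := h3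
      _ = _ := by ring
  have e : (2 : ℝ) - (1 + η) = 1 - η := by ring
  rw [e] at h4
  exact h4

/-- Exponent un-bending at loss `ε/3`: from `x^(1-ε/3) < K · R^(1+ε/3)` (`0 < ε ≤ 1`, `R, x ≥ 1`) to
`x < K^(1/(1-ε/3)) · R^(1+ε)` (uses `(1+ε/3)/(1-ε/3) ≤ 1+ε ⟺ ε ≤ 1`). -/
theorem unbend_third {ε K R x : ℝ} (hε : 0 < ε) (hε1 : ε ≤ 1) (hK : 0 < K) (hR : 1 ≤ R) (hx : 1 ≤ x)
    (h : x ^ (1 - ε / 3) < K * R ^ (1 + ε / 3)) :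
    x < K ^ (1 / (1 - ε / 3)) * R ^ (1 + ε) := by
  have he0 : 0 < 1 - ε / 3 := by linarith
  have hx0 : 0 ≤ x := by linarith
  have hR0 : 0 ≤ R := by linarith
  have hlhs : 0 ≤ x ^ (1 - ε / 3) := Real.rpow_nonneg hx0 _
  have step1 : x = (x ^ (1 - ε / 3)) ^ (1 / (1 - ε / 3)) := by
    rw [one_div, Real.rpow_rpow_inv hx0 he0.ne']
  have step2 : (x ^ (1 - ε / 3)) ^ (1 / (1 - ε / 3)) <
      (K * R ^ (1 + ε / 3)) ^ (1 / (1 - ε / 3)) :=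
    Real.rpow_lt_rpow hlhs h (by positivity)
  have step3 : (K * R ^ (1 + ε / 3)) ^ (1 / (1 - ε / 3)) =
      K ^ (1 / (1 - ε / 3)) * R ^ ((1 + ε / 3) * (1 / (1 - ε / 3))) := by
    rw [Real.mul_rpow hK.le (Real.rpow_nonneg hR0 _), ← Real.rpow_mul hR0]
  have step4 : R ^ ((1 + ε / 3) * (1 / (1 - ε / 3))) ≤ R ^ (1 + ε) := by
    apply Real.rpow_le_rpow_of_exponent_le hR
    rw [mul_one_div, div_le_iff₀ he0]
    nlinarith
  have hKp : 0 ≤ K ^ (1 / (1 - ε / 3)) := Real.rpow_nonneg hK.le _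
  calc x = (x ^ (1 - ε / 3)) ^ (1 / (1 - ε / 3)) := step1
    _ < (K * R ^ (1 + ε / 3)) ^ (1 / (1 - ε / 3)) := step2
    _ = K ^ (1 / (1 - ε / 3)) * R ^ ((1 + ε / 3) * (1 / (1 - ε / 3))) := step3
    _ ≤ K ^ (1 / (1 - ε / 3)) * R ^ (1 + ε) := mul_le_mul_of_nonneg_left step4 hKp

/-- **O1, exact: abc for SQUARE tops already implies abc** (unconditionally — no residual, no Faltings):
every abc-triple breeds into a square-top one of comparable quality by `breed_sq`. -/
theorem squareTopABC_imp_abc : SquareTopABC → _root_.ABC := by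
  intro hS ε hε
  have hε₀ : 0 < min ε 1 := lt_min hε one_pos
  have hε₀1 : min ε 1 ≤ 1 := min_le_right _ _
  have hε₀ε : min ε 1 ≤ ε := min_le_left _ _
  obtain ⟨C₁, hC₁, H₁⟩ := hS (min ε 1 / 3) (by positivity)
  have hK0 : (0 : ℝ) < (4 * C₁) ^ (1 / (1 - min ε 1 / 3)) := Real.rpow_pos_of_pos (by positivity) _
  refine ⟨(4 * C₁) ^ (1 / (1 - min ε 1 / 3)), hK0, ?_⟩
  intro a b c ht
  have hc : 0 < c := by obtain ⟨ha, -, habc, -⟩ := ht; omega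
  have hR1 := one_le_rad_real a b c
  obtain ⟨A, B, C, hT, hsq, hsize, hrad⟩ := breed_sq ht
  have h := transfer_sq (η := min ε 1 / 3) (by positivity) (by linarith) hC₁ H₁ hc hT hsq hsize hrad
  have h' := unbend_third hε₀ hε₀1 (by positivity : (0 : ℝ) < 4 * C₁) hR1 (by exact_mod_cast hc) h
  calc (c : ℝ) < (4 * C₁) ^ (1 / (1 - min ε 1 / 3)) * ((rad a b c : ℕ) : ℝ) ^ (1 + min ε 1) := h'
    _ ≤ (4 * C₁) ^ (1 / (1 - min ε 1 / 3)) * ((rad a b c : ℕ) : ℝ) ^ (1 + ε) :=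
        mul_le_mul_of_nonneg_left (Real.rpow_le_rpow_of_exponent_le hR1 (by linarith)) hK0.le

/-- **abc ⟺ abc for square tops**, unconditionally. -/
theorem abc_iff_squareTopABC : _root_.ABC ↔ SquareTopABC :=
  ⟨abc_imp_squareTopABC, squareTopABC_imp_abc⟩

/-- **Both halves of the parity cut are interchangeable**: modulo the Faltings-grade residual,
abc for non-square tops ⟺ abc for square tops (⟺ abc).  The parity of the top is a two-sided WLOG. -/
theorem nonSquareTopABC_iff_squareTopABC (hR : SquareTopResidualFinite) :
    NonSquareTopABC ↔ SquareTopABC :=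
  (abc_iff_nonSquareTopABC hR).symm.trans abc_iff_squareTopABC

/-- Unconditional direction between the two halves: square-top abc ⟹ non-square-top abc. -/
theorem nonSquareTopABC_of_squareTopABC : SquareTopABC → NonSquareTopABC :=
  fun h => abc_imp_nonSquareTopABC (squareTopABC_imp_abc h)

#print axioms abc_iff_nonSquareTopABC
#print axioms abc_iff_squareTopABC
#print axioms nonSquareTopABC_iff_squareTopABC

end Summit.ABC.ABC.Cruxes.NonSquareTopABC.EquivalenceAudit
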